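import Literature.NumberTheory.Rogawski1990.GlobalAPacketMembership              -- ★ D6 `MemXiFamily`, `IsXiLocalFamily`, `LocalConstituentsIn`, `LocalAPacket.mem_members_iff`
import Literature.NumberTheory.Rogawski1990.CharIdentityOnTestFunctionsSigned   -- ★ K2 `CMCharIdentityPackageTestSigned` (the SIGNED Q-package of record)
import Literature.NumberTheory.Rogawski1990.CharIdentityOnTestFunctions         -- ★ `LocalAPacket.CharIdentityAtTest`
import Literature.NumberTheory.Rogawski1990.LocalTransferExistence              -- ★ (H₇) `IsLocalDeltaTransferExists`
import Literature.NumberTheory.Rogawski1990.XiLocalCharacter                    -- ★ `OneDimAutRepH.xiLocalChar`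
import Literature.NumberTheory.Rogawski1990.LocalTransferFundamentalLemma       -- ★ `IsLocSmooth`
import Literature.NumberTheory.Automorphic.LocalUnitaryGroupCongrInner          -- ★ K5 `exists_cmDatumLocalCongr_eq_apply_conj` (congruence independence, `N` odd)
import Literature.NumberTheory.Automorphic.IrreducibleClassesComapInner         -- ★ `IrrClass.comap_symm_eq_comap_symm_of_forall_eq_conj`
import HarnessLib

/-!
# F0 · P3c · line LH10 «(D-b)ᵀ» — (O2-RED): THE ENVELOPE TRICHOTOMY AT A NON-SPLIT PLACE and THE PEEL OF ORGAN (O2) TO ITS PRINT CORE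

Cell `pub/hodgecm-mathlib`, crux H413 = `stmt-HodgeConjecture-24833` (lane `--supports`), route HCCMUnconditional; seat LH10-p01 (g0); DEALT BY NAME by LH10-plan (g0)
(«DEALS ROUND 2», `F0/P3c/STATUS.md` 2026-09-02T02:45:18Z ∕ 02:46:03Z) against the LH10 pay-down skeleton v1 `F0/P3c/LH10/LH10-plan/g0/DbT.paydown.skeleton.v1.lean`
8dc0ca8b66eb155b, organ (O2) `StubXiPacketRigidAtRecord` :119–:174 «RIGIDITY OF Π(ξ) AT A NON-SPLIT PLACE, RECORD CURRENCY, SIGNED» [Rogawski1990 Thm. 13.3.6 (c)].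
THEOREMS ONLY, sorry-free, no definition ∕ instance ∕ notation ∕ named fact; no `Cruxes/**` import (the organ text is RESTATED token for token as the peel's conclusion, so
that skeleton v2 closes `stub_xiPacketRigidAtRecord` by `exact stubXiPacketRigidAtRecord_of_core stub_core`).  HONEST LABEL: HC_CM is proved only modulo the printed citations
(2 remaining named inputs hLiu418 24832, h413 24833) until rung 0 closes; this file proves NO printed statement — §1 is D6 bookkeeping, §2 takes the print core ‹O2♭› as a
HYPOTHESIS.

## §1 THE ENVELOPE TRICHOTOMY (`constituent_trichotomy_of_memXiFamily`, letter-free)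
D6 ★ `MemXiFamily P hH hHd μω hμu ξ` says: some ξ-local family `Pv` (★ `IsXiLocalFamily`) contains every finite local constituent of `P` (★ `LocalConstituentsIn`); at a NON-SPLIT
`v` the family's packet is `⟨x ∘ e′, s⟩` for SOME form congruence `e′⁻¹ = cmDatumLocalCongr L v T′ ha′ h′`, a constituent `x` of the principal series `i_G(χ_ξ)` and an optional
SUPERCUSPIDAL `s`.  With Keys labels `(π², πⁿ)` at `(μω_v, η_v, ψ_v)` (★ `KeysCaseTwoLabels`: the constituents are exactly `{πⁿ, π²}`) and ANY form congruence
`e⁻¹ = cmDatumLocalCongr L v T ha h` of an `H` with `ᵗH̄ = H` — two congruences differ by an INNER automorphism of `U(Φ₃)(L⁺_v)` for `N = 3` odd (★ K5), so transported classes do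
not depend on the congruence (★ `IrrClass.comap_symm_eq_comap_symm_of_forall_eq_conj`) — EVERY `v`-constituent `c` of `P` is `πⁿ ∘ e`, OR `π² ∘ e`, OR SUPERCUSPIDAL.
No measure, no square-integrability label is used. [Rogawski1990 §12.2 (2) p. 174; §13.1 p. 199; §13.3 p. 201]

## §2 THE PEEL (`stubXiPacketRigidAtRecord_of_core : ‹O2♭› → ‹O2›`)
‹O2♭› («THE 13.3.6 (c) CORE», still PRINT, smaller and honest) = the outer binders of (O2) verbatim (record-currency data `(Δ, m_H, m_G, ν_G, ν_H)`, `ν_G` Haar, Rogawski's `μω`, the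
SIGNED Q-package `hQS : CMCharIdentityPackageTestSigned …`, (H₇), `ξ`, an automorphic measure, a discrete `P` with `MemXiFamily P … ξ`, a non-split `v`, a form congruence
`(T, a)`, a Haar `μZ`, Keys labels `(π², πⁿ)` with `πⁿ` not square-integrable) ⟹ (α) NO `v`-constituent of `P` is `π² ∘ e` («`π²(ξ_v)` is not in the A-packet `Π(ξ_v)`»,
[Rogawski1990 Thm. 13.3.6 (c), §12.2 (2), §13.1 p. 199]) ∧ (β) every SUPERCUSPIDAL `v`-constituent `c` of `P` completes `πⁿ ∘ e` in the SIGNED character identity (13.1.4) on test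
functions at `ξ_v = ξ.xiLocalChar v` («`c = πˢ(ξ_v) ∘ e`», [Rogawski1990 Thm. 13.3.6 (c) + Prop. 13.1.3 (d); §4.9 p. 55 for the sign `ε_v(a)` at the tree's factor `Δ‴`]).
(O2) = «every `v`-constituent is `πⁿ ∘ e` OR completes it (signed)» follows from §1: the `π² ∘ e` branch is excluded by (α), the supercuspidal branch is (β).

## References
* [Rogawski1990] J. Rogawski, Ann. of Math. Stud. 123 (1990): §12.2 (2) pp. 173–174; §13.1 Prop. 13.1.3 (d), Prop. 13.1.4 p. 199; §13.3 Thm. 13.3.5, Thm. 13.3.6 (c)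
  pp. 201–203; §4.9 p. 55; §14.2 p. 234; §14.6 p. 246.
* [LanglandsShelstad1987] R. Langlands, D. Shelstad, Math. Ann. 278 (1987): §1.  [BushnellHenniart2006] Grundlehren 335: §1.1 (classes under inner automorphisms).
-/

set_option autoImplicit false
-- the mandated namespace has the single-problem summit's repeated segment (`HodgeConjecture.HodgeConjecture`)
set_option linter.dupNamespace false

noncomputable section

open NumberField IsDedekindDomain MeasureTheory
open scoped Matrix ComplexOrder

open Literature.NumberTheory Literature.NumberTheory.Automorphic Literature.NumberTheory.Automorphic.UnitaryGroup
open Literature.NumberTheory.Automorphic.IdeleClassGroup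
open Literature.NumberTheory.GaloisRepresentations
open Literature.NumberTheory.Rogawski1990

namespace Summit.HodgeConjecture.HodgeConjecture.Cruxes.H413.F0P3cDbTEnvelopeTrichotomy

variable (L : Type) [Field L] [NumberField L] [IsCMField L] (H : Matrix (Fin 3) (Fin 3) L)

/-! ## §1 The envelope trichotomy at a non-split place -/

set_option synthInstance.maxHeartbeats 400000 in
set_option maxHeartbeats 8000000 in
/-- **Transported classes do not depend on the form congruence** (`N = 3` odd): for two form congruences `ᵗT̄ H_v T = a Φ₃`, `ᵗT̄′ H_v T′ = a′ Φ₃` of an `H` with `ᵗH̄ = H`,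
`comap e⁻¹ c′ = comap e′⁻¹ c′` for EVERY class `c′` of `U(Φ₃)(L⁺_v)` — the two congruences differ by an inner automorphism (★ K5 `exists_cmDatumLocalCongr_eq_apply_conj`) and
classes are blind to inner automorphisms (★ `IrrClass.comap_symm_eq_comap_symm_of_forall_eq_conj`). [cite: Rogawski1990, §14.2 p. 234; §12.2 p. 173] [cite: BushnellHenniart2006, §1.1] -/
theorem comap_cmDatumLocalCongr_symm_eq (hH : (H.map (cmConjRingHom L))ᵀ = H) {v : HeightOneSpectrum (𝓞 ↥(maximalRealSubfield L))}
    (T T' : GL (Fin 3) (LocalRing L v)) {a a' : LocalRing L v} (ha : IsUnit a) (ha' : IsUnit a')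
    (h : formCongr (conjLocal L (IsCMField.complexConj L) v) T (H.map (algebraMap L (LocalRing L v))) =
      a • (Matrix.of fun i j : Fin 3 => if i.val + j.val + 1 = 3 then (1 : L) else 0).map (algebraMap L (LocalRing L v)))
    (h' : formCongr (conjLocal L (IsCMField.complexConj L) v) T' (H.map (algebraMap L (LocalRing L v))) =
      a' • (Matrix.of fun i j : Fin 3 => if i.val + j.val + 1 = 3 then (1 : L) else 0).map (algebraMap L (LocalRing L v)))
    (c' : IrrClass (Gqs L v)) :
    IrrClass.comap (cmDatumLocalCongr L v T ha h).symm c' = IrrClass.comap (cmDatumLocalCongr L v T' ha' h').symm c' := by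
  obtain ⟨u, hu⟩ := UnitaryGroup.exists_cmDatumLocalCongr_eq_apply_conj L (N := 3) ⟨1, rfl⟩ hH v T T' ha ha' h h'
  exact IrrClass.comap_symm_eq_comap_symm_of_forall_eq_conj (cmDatumLocalCongr L v T ha h) (cmDatumLocalCongr L v T' ha' h')
    (cmDatumLocalCongr L v T ha h u) (fun g => by rw [hu g, map_mul, map_mul, map_inv]) c'

set_option synthInstance.maxHeartbeats 400000 in
set_option maxHeartbeats 8000000 in
/-- **§1 THE ENVELOPE TRICHOTOMY AT A NON-SPLIT PLACE** (D6 bookkeeping, letter-free).  If the discrete automorphic `P` of `U(H)(𝔸)` lies in a ξ-local family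
(★ `MemXiFamily P hH hHd μω hμu ξ`), then at a finite place `v` of `L⁺` NOT split in `L`, for every form congruence `ᵗT̄ H_v T = a Φ₃` and every pair of Keys labels `(π², πⁿ)` of
`JH(i_G(χ_ξ))` at `(μω_v, η_v, ψ_v)` (★ `KeysCaseTwoLabels`), EVERY `v`-constituent `c` of `P` (D6 currency: `comap (localPiEquiv v) c ∈ JH(P_f^∞ ∘ inclPlace v)`) is the
transported label `πⁿ ∘ e`, or the transported label `π² ∘ e`, or SUPERCUSPIDAL — the family's packet at `v` is `⟨x ∘ e′, s⟩` with `x ∈ JH(i_G(χ_ξ)) = {πⁿ, π²}` and `s`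
supercuspidal, and `x ∘ e′ = x ∘ e` (`comap_cmDatumLocalCongr_symm_eq`). [cite: Rogawski1990, §12.2 (2) p. 174; §13.1 p. 199; §13.3 p. 201] -/
theorem constituent_trichotomy_of_memXiFamily (hH : (H.map (cmConjRingHom L))ᵀ = H) (hHd : IsUnit H.det)
    (μω : HeckeCharacter L) (hμu : μω.IsUnitary) (ξ : OneDimAutRepH L)
    {μA : Measure (adelicGroupData (↥(maximalRealSubfield L)) L (IsCMField.complexConj L) 3 H).automorphicQuotient}
    [(adelicGroupData (↥(maximalRealSubfield L)) L (IsCMField.complexConj L) 3 H).IsAutomorphicMeasure μA]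
    (P : DiscreteAutomorphicRep (adelicGroupData (↥(maximalRealSubfield L)) L (IsCMField.complexConj L) 3 H) μA)
    (hmem : MemXiFamily P hH hHd μω hμu ξ)
    (v : HeightOneSpectrum (𝓞 ↥(maximalRealSubfield L))) (hns : ∀ w : PlacesOver L v, IsCMField.complexConj L • w.1 = w.1)
    (T : GL (Fin 3) (LocalRing L v)) (a : LocalRing L v) (ha : IsUnit a)
    (h : formCongr (conjLocal L (IsCMField.complexConj L) v) T (H.map (algebraMap L (LocalRing L v))) =
      a • (Matrix.of fun i j : Fin 3 => if i.val + j.val + 1 = 3 then (1 : L) else 0).map (algebraMap L (LocalRing L v)))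
    (π2 πn : IrrClass (Gqs L v))
    (hK : KeysCaseTwoLabels L v (μω.semilocalComponent L v) (torusLocalComponent L (IsCMField.complexConj L) v ξ.η)
      (torusLocalComponent L (IsCMField.complexConj L) v ξ.ψ) π2 πn)
    (c : IrrClass ((cmDatum L 3 H).Local v))
    (hc : (IrrClass.comap (localPiEquiv L (IsCMField.complexConj L) 3 H v) c).IsConstituentOf
      (P.finRep.smoothPart.toRepresentation.comp (inclPlace (↥(maximalRealSubfield L)) L (IsCMField.complexConj L) 3 H v))) :
    c = IrrClass.comap (cmDatumLocalCongr L v T ha h).symm πn ∨ c = IrrClass.comap (cmDatumLocalCongr L v T ha h).symm π2 ∨ c.IsSupercuspidal := by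
  obtain ⟨Pv, hfam, hin⟩ := hmem
  obtain ⟨T', a', ha', h', x, s, hPv, hx, hs⟩ := hfam.2 v hns
  have hcm : c ∈ (Pv v).members := hin v c hc
  rw [hPv, LocalAPacket.mem_members_iff] at hcm
  rcases hcm with hcx | hcs
  · -- `c = x ∘ e′` with `x ∈ {πⁿ, π²}`; move to the given congruence `e`
    rcases (hK.2 x).1 hx with hxn | hx2
    · exact Or.inl (by rw [hcx, hxn, comap_cmDatumLocalCongr_symm_eq L H hH T' T ha' ha h' h])
    · exact Or.inr (Or.inl (by rw [hcx, hx2, comap_cmDatumLocalCongr_symm_eq L H hH T' T ha' ha h' h]))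
  · exact Or.inr (Or.inr (hs c hcs))

/-! ## §2 The peel of organ (O2) to its print core ‹O2♭› -/

open scoped Classical in
set_option synthInstance.maxHeartbeats 400000 in
set_option maxHeartbeats 8000000 in
/-- **§2 THE PEEL `‹O2♭› → ‹O2›`** — the LH10 skeleton's organ (O2) `StubXiPacketRigidAtRecord` (its text :119–:174, RESTATED token for token as the conclusion) from its PRINT
CORE ‹O2♭› (the hypothesis; [Rogawski1990 Thm. 13.3.6 (c)] in D6 currency, at record-currency data with the SIGNED Q-package, (H₇) and Haar `ν_G`): (α) no `v`-constituent of a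
`P` in the ξ-local family is `π² ∘ e`; (β) every SUPERCUSPIDAL `v`-constituent completes `πⁿ ∘ e` in the SIGNED (13.1.4) on test functions at `ξ.xiLocalChar v`.  Proof: the
envelope trichotomy (§1) — `πⁿ ∘ e` is the left disjunct, `π² ∘ e` is excluded by (α), a supercuspidal constituent is sent to the right disjunct by (β).  NOTHING printed is proved
here. [cite: Rogawski1990, §13.3 Thm. 13.3.5, Thm. 13.3.6 (c) pp. 201–203; §12.2 (2) p. 174; §13.1 Prop. 13.1.3 (d), Prop. 13.1.4 p. 199; §4.9 p. 55; §14.6 p. 246]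
[cite: LanglandsShelstad1987, §1] -/
theorem stubXiPacketRigidAtRecord_of_core
    (hcore : ∀ (L : Type) [Field L] [NumberField L] [IsCMField L] (H : Matrix (Fin 3) (Fin 3) L)
      (hH : (H.map (cmConjRingHom L))ᵀ = H) (hHd : IsUnit H.det)
      [∀ v : HeightOneSpectrum (𝓞 ↥(maximalRealSubfield L)), MeasurableSpace ((cmDatum L 3 H).Local v)]
      [∀ v : HeightOneSpectrum (𝓞 ↥(maximalRealSubfield L)),
        MeasurableSpace ((cmDatum L 2 (Matrix.of fun i j : Fin 2 => if i.val + j.val + 1 = 2 then (1 : L) else 0)).Local v ×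
          (cmDatum L 1 (Matrix.of fun i j : Fin 1 => if i.val + j.val + 1 = 1 then (1 : L) else 0)).Local v)]
      [∀ (v : HeightOneSpectrum (𝓞 ↥(maximalRealSubfield L)))
          (a : ((cmDatum L 2 (Matrix.of fun i j : Fin 2 => if i.val + j.val + 1 = 2 then (1 : L) else 0)).Local v ×
            (cmDatum L 1 (Matrix.of fun i j : Fin 1 => if i.val + j.val + 1 = 1 then (1 : L) else 0)).Local v)),
        MeasurableSpace (((cmDatum L 2 (Matrix.of fun i j : Fin 2 => if i.val + j.val + 1 = 2 then (1 : L) else 0)).Local v ×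
            (cmDatum L 1 (Matrix.of fun i j : Fin 1 => if i.val + j.val + 1 = 1 then (1 : L) else 0)).Local v) ⧸
          Subgroup.centralizer ({a} : Set ((cmDatum L 2 (Matrix.of fun i j : Fin 2 => if i.val + j.val + 1 = 2 then (1 : L) else 0)).Local v ×
            (cmDatum L 1 (Matrix.of fun i j : Fin 1 => if i.val + j.val + 1 = 1 then (1 : L) else 0)).Local v)))]
      [∀ (v : HeightOneSpectrum (𝓞 ↥(maximalRealSubfield L))) (γ : (cmDatum L 3 H).Local v),
        MeasurableSpace ((cmDatum L 3 H).Local v ⧸ Subgroup.centralizer ({γ} : Set ((cmDatum L 3 H).Local v)))]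
      (Δ : ∀ v : HeightOneSpectrum (𝓞 ↥(maximalRealSubfield L)), LocalTransferFactor L H v)
      (mH : ∀ v : HeightOneSpectrum (𝓞 ↥(maximalRealSubfield L)),
        OrbitalMeasureFamily ((cmDatum L 2 (Matrix.of fun i j : Fin 2 => if i.val + j.val + 1 = 2 then (1 : L) else 0)).Local v ×
          (cmDatum L 1 (Matrix.of fun i j : Fin 1 => if i.val + j.val + 1 = 1 then (1 : L) else 0)).Local v))
      (mG : ∀ v : HeightOneSpectrum (𝓞 ↥(maximalRealSubfield L)), OrbitalMeasureFamily ((cmDatum L 3 H).Local v))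
      (νG : ∀ v : HeightOneSpectrum (𝓞 ↥(maximalRealSubfield L)), Measure ((cmDatum L 3 H).Local v))
      (νH : ∀ v : HeightOneSpectrum (𝓞 ↥(maximalRealSubfield L)),
        Measure ((cmDatum L 2 (Matrix.of fun i j : Fin 2 => if i.val + j.val + 1 = 2 then (1 : L) else 0)).Local v ×
          (cmDatum L 1 (Matrix.of fun i j : Fin 1 => if i.val + j.val + 1 = 1 then (1 : L) else 0)).Local v)),
      (∀ v, (νG v).IsHaarMeasure) →
      ∀ (μω : HeckeCharacter L) (hμu : μω.IsUnitary),
      (∀ x : Literature.NumberTheory.GaloisRepresentations.ideleGroup ↥(maximalRealSubfield L),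
        μω (AdeleRing.ideleBaseChange (↥(maximalRealSubfield L)) L x) = quadraticHeckeCharCM L x) →
      CMCharIdentityPackageTestSigned L H hH hHd νH νG μω hμu Δ mH mG →
      (∀ v : HeightOneSpectrum (𝓞 ↥(maximalRealSubfield L)), (∀ w : PlacesOver L v, IsCMField.complexConj L • w.1 = w.1) →
        IsLocalDeltaTransferExists L H v (Δ v) (mH v) (mG v) Literature.NumberTheory.Rogawski1990.IsLocSmooth
          Literature.NumberTheory.Rogawski1990.IsLocSmooth) →
      ∀ (ξ : OneDimAutRepH L)
        (μA : Measure (adelicGroupData (↥(maximalRealSubfield L)) L (IsCMField.complexConj L) 3 H).automorphicQuotient)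
        [(adelicGroupData (↥(maximalRealSubfield L)) L (IsCMField.complexConj L) 3 H).IsAutomorphicMeasure μA]
        (P : DiscreteAutomorphicRep (adelicGroupData (↥(maximalRealSubfield L)) L (IsCMField.complexConj L) 3 H) μA),
        MemXiFamily P hH hHd μω hμu ξ →
        ∀ (v : HeightOneSpectrum (𝓞 ↥(maximalRealSubfield L))), (∀ w : PlacesOver L v, IsCMField.complexConj L • w.1 = w.1) →
        ∀ (T : GL (Fin 3) (LocalRing L v)) (a : LocalRing L v) (ha : IsUnit a)
          (h : formCongr (conjLocal L (IsCMField.complexConj L) v) T (H.map (algebraMap L (LocalRing L v))) =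
            a • (Matrix.of fun i j : Fin 3 => if i.val + j.val + 1 = 3 then (1 : L) else 0).map (algebraMap L (LocalRing L v))),
        ∀ [MeasurableSpace (Gqs L v ⧸ Subgroup.center (Gqs L v))] [BorelSpace (Gqs L v ⧸ Subgroup.center (Gqs L v))]
          (μZ : Measure (Gqs L v ⧸ Subgroup.center (Gqs L v))) [μZ.IsHaarMeasure],
        ∀ (π2 πn : IrrClass (Gqs L v)),
          KeysCaseTwoLabels L v (μω.semilocalComponent L v) (torusLocalComponent L (IsCMField.complexConj L) v ξ.η)
            (torusLocalComponent L (IsCMField.complexConj L) v ξ.ψ) π2 πn →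
          ¬ πn.IsSquareIntegrable μZ →
          -- (α) «π²(ξ_v) ∘ e is NOT a v-constituent of P»
          (∀ c : IrrClass ((cmDatum L 3 H).Local v),
            (IrrClass.comap (localPiEquiv L (IsCMField.complexConj L) 3 H v) c).IsConstituentOf
                (P.finRep.smoothPart.toRepresentation.comp (inclPlace (↥(maximalRealSubfield L)) L (IsCMField.complexConj L) 3 H v)) →
            c ≠ IrrClass.comap (cmDatumLocalCongr L v T ha h).symm π2) ∧
          -- (β) «every SUPERCUSPIDAL v-constituent of P completes πⁿ ∘ e in the SIGNED (13.1.4) on test functions»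
          (∀ c : IrrClass ((cmDatum L 3 H).Local v),
            (IrrClass.comap (localPiEquiv L (IsCMField.complexConj L) 3 H v) c).IsConstituentOf
                (P.finRep.smoothPart.toRepresentation.comp (inclPlace (↥(maximalRealSubfield L)) L (IsCMField.complexConj L) 3 H v)) →
            c.IsSupercuspidal →
            (⟨IrrClass.comap (cmDatumLocalCongr L v T ha h).symm πn, some c⟩ : CMLocalAPacket L H v).CharIdentityAtTest L H v
              (fun c' f => (if ∃ z : LocalRing L v, IsUnit z ∧ a = z * conjLocal L (IsCMField.complexConj L) v z then (1 : ℂ) else -1) *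
                c'.smoothTrace (νG v) f)
              (ξ.xiLocalChar v) (νH v) (Δ v) (mH v) (mG v))) :
    -- ‹O2› = `StubXiPacketRigidAtRecord` of the LH10 skeleton v1 (:119–:174), token for token
    ∀ (L : Type) [Field L] [NumberField L] [IsCMField L] (H : Matrix (Fin 3) (Fin 3) L)
      (hH : (H.map (cmConjRingHom L))ᵀ = H) (hHd : IsUnit H.det)
      [∀ v : HeightOneSpectrum (𝓞 ↥(maximalRealSubfield L)), MeasurableSpace ((cmDatum L 3 H).Local v)]
      [∀ v : HeightOneSpectrum (𝓞 ↥(maximalRealSubfield L)),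
        MeasurableSpace ((cmDatum L 2 (Matrix.of fun i j : Fin 2 => if i.val + j.val + 1 = 2 then (1 : L) else 0)).Local v ×
          (cmDatum L 1 (Matrix.of fun i j : Fin 1 => if i.val + j.val + 1 = 1 then (1 : L) else 0)).Local v)]
      [∀ (v : HeightOneSpectrum (𝓞 ↥(maximalRealSubfield L)))
          (a : ((cmDatum L 2 (Matrix.of fun i j : Fin 2 => if i.val + j.val + 1 = 2 then (1 : L) else 0)).Local v ×
            (cmDatum L 1 (Matrix.of fun i j : Fin 1 => if i.val + j.val + 1 = 1 then (1 : L) else 0)).Local v)),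
        MeasurableSpace (((cmDatum L 2 (Matrix.of fun i j : Fin 2 => if i.val + j.val + 1 = 2 then (1 : L) else 0)).Local v ×
            (cmDatum L 1 (Matrix.of fun i j : Fin 1 => if i.val + j.val + 1 = 1 then (1 : L) else 0)).Local v) ⧸
          Subgroup.centralizer ({a} : Set ((cmDatum L 2 (Matrix.of fun i j : Fin 2 => if i.val + j.val + 1 = 2 then (1 : L) else 0)).Local v ×
            (cmDatum L 1 (Matrix.of fun i j : Fin 1 => if i.val + j.val + 1 = 1 then (1 : L) else 0)).Local v)))]
      [∀ (v : HeightOneSpectrum (𝓞 ↥(maximalRealSubfield L))) (γ : (cmDatum L 3 H).Local v),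
        MeasurableSpace ((cmDatum L 3 H).Local v ⧸ Subgroup.centralizer ({γ} : Set ((cmDatum L 3 H).Local v)))]
      (Δ : ∀ v : HeightOneSpectrum (𝓞 ↥(maximalRealSubfield L)), LocalTransferFactor L H v)
      (mH : ∀ v : HeightOneSpectrum (𝓞 ↥(maximalRealSubfield L)),
        OrbitalMeasureFamily ((cmDatum L 2 (Matrix.of fun i j : Fin 2 => if i.val + j.val + 1 = 2 then (1 : L) else 0)).Local v ×
          (cmDatum L 1 (Matrix.of fun i j : Fin 1 => if i.val + j.val + 1 = 1 then (1 : L) else 0)).Local v))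
      (mG : ∀ v : HeightOneSpectrum (𝓞 ↥(maximalRealSubfield L)), OrbitalMeasureFamily ((cmDatum L 3 H).Local v))
      (νG : ∀ v : HeightOneSpectrum (𝓞 ↥(maximalRealSubfield L)), Measure ((cmDatum L 3 H).Local v))
      (νH : ∀ v : HeightOneSpectrum (𝓞 ↥(maximalRealSubfield L)),
        Measure ((cmDatum L 2 (Matrix.of fun i j : Fin 2 => if i.val + j.val + 1 = 2 then (1 : L) else 0)).Local v ×
          (cmDatum L 1 (Matrix.of fun i j : Fin 1 => if i.val + j.val + 1 = 1 then (1 : L) else 0)).Local v)),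
      (∀ v, (νG v).IsHaarMeasure) →
      ∀ (μω : HeckeCharacter L) (hμu : μω.IsUnitary),
      (∀ x : Literature.NumberTheory.GaloisRepresentations.ideleGroup ↥(maximalRealSubfield L),
        μω (AdeleRing.ideleBaseChange (↥(maximalRealSubfield L)) L x) = quadraticHeckeCharCM L x) →
      CMCharIdentityPackageTestSigned L H hH hHd νH νG μω hμu Δ mH mG →
      (∀ v : HeightOneSpectrum (𝓞 ↥(maximalRealSubfield L)), (∀ w : PlacesOver L v, IsCMField.complexConj L • w.1 = w.1) →
        IsLocalDeltaTransferExists L H v (Δ v) (mH v) (mG v) Literature.NumberTheory.Rogawski1990.IsLocSmooth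
          Literature.NumberTheory.Rogawski1990.IsLocSmooth) →
      ∀ (ξ : OneDimAutRepH L)
        (μA : Measure (adelicGroupData (↥(maximalRealSubfield L)) L (IsCMField.complexConj L) 3 H).automorphicQuotient)
        [(adelicGroupData (↥(maximalRealSubfield L)) L (IsCMField.complexConj L) 3 H).IsAutomorphicMeasure μA]
        (P : DiscreteAutomorphicRep (adelicGroupData (↥(maximalRealSubfield L)) L (IsCMField.complexConj L) 3 H) μA),
        MemXiFamily P hH hHd μω hμu ξ →
        ∀ (v : HeightOneSpectrum (𝓞 ↥(maximalRealSubfield L))), (∀ w : PlacesOver L v, IsCMField.complexConj L • w.1 = w.1) →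
        ∀ (T : GL (Fin 3) (LocalRing L v)) (a : LocalRing L v) (ha : IsUnit a)
          (h : formCongr (conjLocal L (IsCMField.complexConj L) v) T (H.map (algebraMap L (LocalRing L v))) =
            a • (Matrix.of fun i j : Fin 3 => if i.val + j.val + 1 = 3 then (1 : L) else 0).map (algebraMap L (LocalRing L v))),
        ∀ [MeasurableSpace (Gqs L v ⧸ Subgroup.center (Gqs L v))] [BorelSpace (Gqs L v ⧸ Subgroup.center (Gqs L v))]
          (μZ : Measure (Gqs L v ⧸ Subgroup.center (Gqs L v))) [μZ.IsHaarMeasure],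
        ∀ (π2 πn : IrrClass (Gqs L v)),
          KeysCaseTwoLabels L v (μω.semilocalComponent L v) (torusLocalComponent L (IsCMField.complexConj L) v ξ.η)
            (torusLocalComponent L (IsCMField.complexConj L) v ξ.ψ) π2 πn →
          ¬ πn.IsSquareIntegrable μZ →
          ∀ c : IrrClass ((cmDatum L 3 H).Local v),
            (IrrClass.comap (localPiEquiv L (IsCMField.complexConj L) 3 H v) c).IsConstituentOf
                (P.finRep.smoothPart.toRepresentation.comp (inclPlace (↥(maximalRealSubfield L)) L (IsCMField.complexConj L) 3 H v)) →
            c = IrrClass.comap (cmDatumLocalCongr L v T ha h).symm πn ∨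
              (⟨IrrClass.comap (cmDatumLocalCongr L v T ha h).symm πn, some c⟩ : CMLocalAPacket L H v).CharIdentityAtTest L H v
                (fun c' f => (if ∃ z : LocalRing L v, IsUnit z ∧ a = z * conjLocal L (IsCMField.complexConj L) v z then (1 : ℂ) else -1) *
                  c'.smoothTrace (νG v) f)
                (ξ.xiLocalChar v) (νH v) (Δ v) (mH v) (mG v) := by
  intro L _ _ _ H hH hHd _ _ _ _ Δ mH mG νG νH hνG μω hμu hμω hQS hex ξ μA _ P hmem v hns T a ha h _ _ μZ _ π2 πn hK hn c hc
  obtain ⟨hα, hβ⟩ := hcore L H hH hHd Δ mH mG νG νH hνG μω hμu hμω hQS hex ξ μA P hmem v hns T a ha h μZ π2 πn hK hn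
  rcases constituent_trichotomy_of_memXiFamily L H hH hHd μω hμu ξ P hmem v hns T a ha h π2 πn hK c hc with hcn | hc2 | hsc
  · exact Or.inl hcn
  · exact absurd hc2 (hα c hc)
  · exact Or.inr (hβ c hc hsc)

end Summit.HodgeConjecture.HodgeConjecture.Cruxes.H413.F0P3cDbTEnvelopeTrichotomy

end
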